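import Mathlib
import Summits.ValiantsHypothesis.ValiantsHypothesis.Theorems.NewtonUnitEquationsTwoProductsFormalLogLinearisationDefs
import Summits.ValiantsHypothesis.ValiantsHypothesis.Theorems.TwoProducts.Negative.RowCoincidenceThreeDigitBox
import HarnessLib

/-!
# A second, scale-free exception to box row-coincidence: the square-difference witness

Negative lane, `--supports stmt-ValiantsHypothesis-5906` (route `NewtonUnitEquations`, crux `TwoProducts`, line
`relation_ladder` / idea `subbox-congruence-cascade`). No summit statement is proved here.

`RowCoincidenceThreeDigitBox` (accepted) exhibits the top-letter pencil family `E_T`. This file records a DIFFERENT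
mechanism, found by an exact enumeration of the class-(3,3) exceptional locus (memo `EXCEPTIONS-33`): with
`Z := X^(1,1)` and `T := X^(4,4)`,

  `(1 − Z)² · 1 − (1 − Z − T)(1 − Z + T) = T² = X^(8,8)`.

So for the tails `u = (−2Z + Z², 0)` and `v = (−Z − T, −Z + T)` (all exponents on the digit grid, base 2):
the tail difference is the single monomial `X^(8,8)`; `p = (8,8)` is LL-visible; the `[0,8)²`-truncated rows are the
rows themselves and are NOT equal as multisets (`truncated_rows_ne`); moreover they do NOT agree after deleting the
`T`-coefficients (`rows_modT_ne`) and do NOT lie in a pencil `span{r, T}` (`not_pencil`) — the two escape clauses of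
the proposed repairs «coincidence modulo the top letter OR pencil containing the top letter». The same identity with
`T_s = X^(2^(s-1),2^(s-1))` gives `X^(2^s,2^s)` for every `s ≥ 2` (scale-free); only `s = 3` is formalised.
[folklore]
-/

set_option linter.dupNamespace false

open scoped BigOperators
open MvPolynomial
open Summit.ValiantsHypothesis.ValiantsHypothesis.Theorems.NewtonUnitEquations.TwoProducts.FormalLogLinearisation
open Summit.ValiantsHypothesis.ValiantsHypothesis.Theorems.NewtonUnitEquations.TwoProducts.Negative.RowCoincidence

namespace Summit.ValiantsHypothesis.ValiantsHypothesis.Theorems.NewtonUnitEquations.TwoProducts.Negative.SquareDifference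

noncomputable section

/-- The letter `Z = (1,1)`. -/
def zz : Expo := Finsupp.single 0 1 + Finsupp.single 1 1

/-- The letter `Z² = (2,2)`. -/
def z2 : Expo := Finsupp.single 0 2 + Finsupp.single 1 2

/-- `Z ≠ Z²`. -/
theorem zz_ne_z2 : zz ≠ z2 := fun h => by have := congrArg (· 0) h; simp [zz, z2] at this
/-- `Z ≠ T`. -/
theorem zz_ne_et : zz ≠ et := fun h => by have := congrArg (· 0) h; simp [zz, et] at this
/-- `Z² ≠ T`. -/
theorem z2_ne_et : z2 ≠ et := fun h => by have := congrArg (· 0) h; simp [z2, et] at this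
/-- `Z ≠ 2T`. -/
theorem zz_ne_pp : zz ≠ pp := fun h => by have := congrArg (· 0) h; simp [zz, pp, et] at this
/-- `Z² ≠ 2T`. -/
theorem z2_ne_pp : z2 ≠ pp := fun h => by have := congrArg (· 0) h; simp [z2, pp, et] at this
/-- `T ≠ 2T`. -/
theorem et_ne_pp : et ≠ pp := fun h => by have := congrArg (· 0) h; simp [pp, et] at this

/-- A three-letter row `a·Z + b·Z² + c·T`. -/
def row3 (a b c : ℂ) : MvPolynomial (Fin 2) ℂ := monomial zz a + monomial z2 b + monomial et c

/-- Coefficients of a three-letter row. -/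
theorem coeff_row3 (a b c : ℂ) (x : Expo) :
    coeff x (row3 a b c) = (if zz = x then a else 0) + (if z2 = x then b else 0) + (if et = x then c else 0) := by
  simp [row3, coeff_monomial]

/-- `coeff Z`. -/
@[simp] theorem coeff_row3_zz (a b c : ℂ) : coeff zz (row3 a b c) = a := by
  simp [coeff_row3, zz_ne_z2.symm, zz_ne_et.symm]
/-- `coeff Z²`. -/
@[simp] theorem coeff_row3_z2 (a b c : ℂ) : coeff z2 (row3 a b c) = b := by
  simp [coeff_row3, zz_ne_z2, z2_ne_et.symm]
/-- `coeff T`. -/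
@[simp] theorem coeff_row3_et (a b c : ℂ) : coeff et (row3 a b c) = c := by
  simp [coeff_row3, zz_ne_et, z2_ne_et]

/-- A row in `C · X₀^i X₁^k` form (for `ring`). -/
theorem row3_eq (a b c : ℂ) :
    row3 a b c = C a * X 0 ^ 1 * X 1 ^ 1 + C b * X 0 ^ 2 * X 1 ^ 2 + C c * X 0 ^ 4 * X 1 ^ 4 := by
  rw [C_mul_X_eq, C_mul_X_eq, C_mul_X_eq]; rfl

/-- f-tails: `u₁ = −2Z + Z²` (so `1 + u₁ = (1 − Z)²`) and `u₂ = 0` (so `1 + u₂ = 1`). -/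
def su : Fin 2 → MvPolynomial (Fin 2) ℂ := ![row3 (-2) 1 0, row3 0 0 0]

/-- g-tails: `v₁ = −Z − T`, `v₂ = −Z + T` (so `(1 + v₁)(1 + v₂) = (1 − Z)² − T²`). -/
def sv : Fin 2 → MvPolynomial (Fin 2) ℂ := ![row3 (-1) 0 (-1), row3 (-1) 0 1]

/-- The tail difference is the single monomial `T² = X^(8,8)`. -/
theorem tailDiff_eq : tailDiff su sv = monomial pp 1 := by
  have hpp : pp = Finsupp.single 0 8 + Finsupp.single 1 8 := by
    ext i; fin_cases i <;> simp [pp, et]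
  have h8 : (monomial pp (1 : ℂ) : MvPolynomial (Fin 2) ℂ) = C 1 * X 0 ^ 8 * X 1 ^ 8 := by
    rw [C_mul_X_eq, hpp]
  simp only [tailDiff, su, sv, Fin.prod_univ_two, Matrix.cons_val_zero, Matrix.cons_val_one]
  rw [h8, row3_eq, row3_eq, row3_eq, row3_eq]
  simp only [map_neg, map_one, map_zero, map_ofNat]
  ring

/-- Coefficients of the tail difference. -/
theorem coeff_tailDiff (x : Expo) : coeff x (tailDiff su sv) = if pp = x then (1 : ℂ) else 0 := by
  rw [tailDiff_eq, coeff_monomial]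

/-- The support of the tail difference is `{2T}`. -/
theorem mem_support_tailDiff {x : Expo} (hx : x ∈ (tailDiff su sv).support) : x = pp := by
  rw [mem_support_iff, coeff_tailDiff] at hx
  by_contra h
  exact hx (by simp [Ne.symm h])

/-- `2T` is in the support. -/
theorem pp_mem_support : pp ∈ (tailDiff su sv).support := by
  rw [mem_support_iff, coeff_tailDiff]; simp

/-- Support of a three-letter row. -/
theorem mem_support_row3 {a b c : ℂ} {x : Expo} (hx : x ∈ (row3 a b c).support) : x = zz ∨ x = z2 ∨ x = et := by
  rw [mem_support_iff, coeff_row3] at hx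
  by_contra h
  push Not at h
  apply hx
  simp [Ne.symm h.1, Ne.symm h.2.1, Ne.symm h.2.2]

/-- Every exponent of a three-letter row has negative `ξ`-weight for `ξ = (−1,−1)`. -/
theorem wt_row3_neg {a b c : ℂ} {x : Expo} (hx : x ∈ (row3 a b c).support) : wt xi x < 0 := by
  rcases mem_support_row3 hx with rfl | rfl | rfl <;> (rw [wt_xi]; norm_num [zz, z2, et])

/-- `ξ = (−1,−1)` is a valid weight for the instance. -/
theorem validWeight_xi : ValidWeight su sv xi := by
  refine ⟨fun j e he => ?_, fun j e he => ?_⟩ <;> fin_cases j <;> exact wt_row3_neg (by simpa [su, sv] using he)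

/-- `2T` is the strict `ξ`-top of the (singleton) tail support. -/
theorem isStrictTop_pp : IsStrictTop xi (↑(tailDiff su sv).support : Set Expo) pp := by
  refine ⟨by exact_mod_cast pp_mem_support, fun μ hμ hne => ?_⟩
  exact absurd (mem_support_tailDiff (by exact_mod_cast hμ)) hne

/-- `p = (8,8)` is LL-visible. -/
theorem pp_mem_llVisible : pp ∈ llVisible su sv :=
  ⟨xi, by simp, by simp, validWeight_xi, isStrictTop_pp⟩

/-- Truncation to the 3-digit box `[0,8)²` does not change a three-letter row (all letters are `< 8`). -/
theorem boxTrunc_row3 (a b c : ℂ) : boxTrunc 8 8 (row3 a b c) = row3 a b c := by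
  ext x
  rw [coeff_boxTrunc]
  by_cases hx : x ∈ (row3 a b c).support
  · rcases mem_support_row3 hx with rfl | rfl | rfl <;> simp [zz, z2, et]
  · rw [notMem_support_iff.1 hx]; simp

/-- Truncated `u`-rows = the `u`-rows. -/
theorem boxTrunc_su : (fun j => boxTrunc 8 8 (su j)) = su := by
  funext j; fin_cases j <;> simp [su, boxTrunc_row3]

/-- Truncated `v`-rows = the `v`-rows. -/
theorem boxTrunc_sv : (fun j => boxTrunc 8 8 (sv j)) = sv := by
  funext j; fin_cases j <;> simp [sv, boxTrunc_row3]

/-- `u₁ = −2Z + Z²` is not a `v`-row (its `Z`-coefficient is `−2`, theirs is `−1`). -/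
theorem su0_notMem : ∀ j, sv j ≠ su 0 := by
  intro j hj
  have hc := congrArg (coeff zz) hj
  fin_cases j <;> simp [su, sv] at hc

/-- The truncated rows of the two sides are NOT equal as multisets. -/
theorem truncated_rows_ne :
    (Finset.univ.val.map fun j => boxTrunc 8 8 (su j)) ≠ (Finset.univ.val.map fun j => boxTrunc 8 8 (sv j)) := by
  rw [boxTrunc_su, boxTrunc_sv]
  intro h
  have hmem : su 0 ∈ (Finset.univ.val.map sv) := by
    rw [← h]; exact Multiset.mem_map.2 ⟨0, Finset.mem_univ_val 0, rfl⟩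
  obtain ⟨j, -, hj⟩ := Multiset.mem_map.1 hmem
  exact su0_notMem j hj

/-- Deleting the `T`-coefficient of a polynomial. -/
def modT (q : MvPolynomial (Fin 2) ℂ) : MvPolynomial (Fin 2) ℂ := q - monomial et (coeff et q)

/-- `modT` of a three-letter row drops the `T`-letter. -/
theorem modT_row3 (a b c : ℂ) : modT (row3 a b c) = row3 a b 0 := by
  simp [modT, row3, zz_ne_et, z2_ne_et]

/-- Even after deleting the `T`-coefficients the rows are NOT equal as multisets
(`{−2Z + Z², 0}` versus `{−Z, −Z}`). -/
theorem rows_modT_ne :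
    (Finset.univ.val.map fun j => modT (su j)) ≠ (Finset.univ.val.map fun j => modT (sv j)) := by
  intro h
  have hmem : modT (su 0) ∈ (Finset.univ.val.map fun j => modT (sv j)) := by
    rw [← h]; exact Multiset.mem_map.2 ⟨0, Finset.mem_univ_val 0, rfl⟩
  obtain ⟨j, -, hj⟩ := Multiset.mem_map.1 hmem
  have hc := congrArg (coeff zz) hj
  fin_cases j <;> simp [su, sv, modT_row3] at hc

/-- The four rows do NOT lie in a pencil `span{r, T}`: no single polynomial `r` has all of `u₁, v₁` in
`ℂ·r + ℂ·T` (compare the `Z`- and `Z²`-coefficients: `u₁ ↦ (−2, 1)`, `v₁ ↦ (−1, 0)` are not parallel). -/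
theorem not_pencil :
    ¬ ∃ r : MvPolynomial (Fin 2) ℂ, ∀ w ∈ ({su 0, su 1, sv 0, sv 1} : Set (MvPolynomial (Fin 2) ℂ)),
        ∃ α β : ℂ, w = α • r + β • monomial et 1 := by
  rintro ⟨r, hr⟩
  obtain ⟨α, β, hu⟩ := hr (su 0) (by simp)
  obtain ⟨γ, δ, hv⟩ := hr (sv 0) (by simp)
  have h2 := congrArg (coeff z2) hu
  have h3 := congrArg (coeff zz) hv
  have h4 := congrArg (coeff z2) hv
  simp [su, sv, coeff_monomial, Ne.symm zz_ne_et, Ne.symm z2_ne_et] at h2 h3 h4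
  -- h2 : 1 = α * coeff z2 r ; h3 : -1 = γ * coeff zz r ; h4 : γ = 0 ∨ coeff z2 r = 0
  have hγ : γ ≠ 0 := by rintro rfl; norm_num at h3
  have hz2 : coeff z2 r = 0 := by rcases h4 with h | h <;> first | exact h | exact absurd h hγ
  rw [hz2, mul_zero] at h2
  norm_num at h2

/-- `Z`, `Z²` are digit-grid letters (base 2, 4 digits — the grid of the accepted `E_T` witness). -/
theorem zz_mem_digitGrid : zz ∈ DigitGrid 4 := ⟨0, 0, by norm_num, by norm_num, by simp [zz], by simp [zz]⟩
/-- `Z²` is a digit-grid letter. -/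
theorem z2_mem_digitGrid : z2 ∈ DigitGrid 4 := ⟨1, 1, by norm_num, by norm_num, by simp [z2], by simp [z2]⟩

/-- All exponents of a three-letter row are on the digit grid. -/
theorem row3_support_digitGrid {a b c : ℂ} : ∀ e ∈ (row3 a b c).support, e ∈ DigitGrid 4 := fun e he => by
  rcases mem_support_row3 he with rfl | rfl | rfl
  · exact zz_mem_digitGrid
  · exact z2_mem_digitGrid
  · exact et_mem_digitGrid

/-- `u`-rows are digit-grid rows. -/
theorem su_digitGrid : ∀ j, ∀ e ∈ (su j).support, e ∈ DigitGrid 4 := by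
  intro j; fin_cases j <;> exact row3_support_digitGrid
/-- `v`-rows are digit-grid rows. -/
theorem sv_digitGrid : ∀ j, ∀ e ∈ (sv j).support, e ∈ DigitGrid 4 := by
  intro j; fin_cases j <;> exact row3_support_digitGrid

/-- THE SQUARE-DIFFERENCE WITNESS: digit-grid (γ1) tails in base 2 with `p = (2³, 2³)` LL-visible whose
`[0,2³)²`-truncated rows (= the rows) are NOT equal as multisets, do NOT agree modulo the top letter `T = (4,4)`,
and do NOT lie in a pencil containing `T`; the tail difference is the monomial `X^p`. -/
theorem squareDifference_witness :
    (∀ j, ∀ e ∈ (su j).support, e ∈ DigitGrid 4) ∧ (∀ j, ∀ e ∈ (sv j).support, e ∈ DigitGrid 4) ∧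
    tailDiff su sv = monomial pp 1 ∧ pp ∈ llVisible su sv ∧ pp 0 = 2 ^ 3 ∧ pp 1 = 2 ^ 3 ∧
    (Finset.univ.val.map fun j => boxTrunc (2 ^ 3) (2 ^ 3) (su j)) ≠
      (Finset.univ.val.map fun j => boxTrunc (2 ^ 3) (2 ^ 3) (sv j)) ∧
    (Finset.univ.val.map fun j => modT (su j)) ≠ (Finset.univ.val.map fun j => modT (sv j)) ∧
    ¬ ∃ r : MvPolynomial (Fin 2) ℂ, ∀ w ∈ ({su 0, su 1, sv 0, sv 1} : Set (MvPolynomial (Fin 2) ℂ)),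
        ∃ α β : ℂ, w = α • r + β • monomial et 1 :=
  ⟨su_digitGrid, sv_digitGrid, tailDiff_eq, pp_mem_llVisible, by simp [pp, et], by simp [pp, et], by
    rw [show (2 : ℕ) ^ 3 = 8 by norm_num]; exact truncated_rows_ne, rows_modT_ne, not_pencil⟩

/-- Hence the «coincidence modulo the top letter OR pencil containing the top letter» repair of row coincidence
below LL-visible points is NOT a law of digit-grid instances either (stated inline; `N = M = 2³ = p₀ = p₁`). -/
theorem not_rowCoincidence_modT_or_pencil_on_digitGrid :
    ¬ (∀ (m s : ℕ) (u v : Fin m → MvPolynomial (Fin 2) ℂ),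
        (∀ j, ∀ e ∈ (u j).support, e ∈ DigitGrid s) → (∀ j, ∀ e ∈ (v j).support, e ∈ DigitGrid s) →
        ∀ p ∈ llVisible u v, ∀ N M : ℕ, N ≤ p 0 + 1 → M ≤ p 1 + 1 → (N ≤ p 0 ∨ M ≤ p 1) →
          ((Finset.univ.val.map fun j => modT (boxTrunc N M (u j))) =
              (Finset.univ.val.map fun j => modT (boxTrunc N M (v j))) ∨
           ∃ r : MvPolynomial (Fin 2) ℂ, ∀ w ∈ (Set.range fun j => boxTrunc N M (u j)) ∪ Set.range fun j => boxTrunc N M (v j),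
              ∃ α β : ℂ, w = α • r + β • monomial et 1)) := by
  intro h
  have h' := h 2 4 su sv su_digitGrid sv_digitGrid pp pp_mem_llVisible 8 8 (by simp [pp, et]) (by simp [pp, et])
    (Or.inl (by simp [pp, et]))
  have e1 : (fun j => modT (boxTrunc 8 8 (su j))) = fun j => modT (su j) := by
    funext j; rw [show boxTrunc 8 8 (su j) = (fun j => boxTrunc 8 8 (su j)) j from rfl, boxTrunc_su]
  have e2 : (fun j => modT (boxTrunc 8 8 (sv j))) = fun j => modT (sv j) := by
    funext j; rw [show boxTrunc 8 8 (sv j) = (fun j => boxTrunc 8 8 (sv j)) j from rfl, boxTrunc_sv]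
  rw [e1, e2] at h'
  rcases h' with h' | ⟨r, hr⟩
  · exact rows_modT_ne h'
  · refine not_pencil ⟨r, fun w hw => hr w ?_⟩
    have hus : ∀ j, boxTrunc 8 8 (su j) = su j := fun j => congrFun boxTrunc_su j
    have hvs : ∀ j, boxTrunc 8 8 (sv j) = sv j := fun j => congrFun boxTrunc_sv j
    simp only [Set.mem_insert_iff, Set.mem_singleton_iff] at hw
    rcases hw with rfl | rfl | rfl | rfl
    · exact Or.inl ⟨0, hus 0⟩
    · exact Or.inl ⟨1, hus 1⟩
    · exact Or.inr ⟨0, hvs 0⟩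
    · exact Or.inr ⟨1, hvs 1⟩

end

end Summit.ValiantsHypothesis.ValiantsHypothesis.Theorems.NewtonUnitEquations.TwoProducts.Negative.SquareDifference
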